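import Mathlib
import Literature.MathematicalPhysics.QuantumLattice.FermiRG.FKTLaddersSec1
import HarnessLib

/-!
# Feldman–Knörrer–Trubowitz, *Particle–Hole Ladders* (CMP 247 (2004) 179), §II.1 "Combinatorial Structure of
# Compound Ladders": Convention II.1, Definition II.2, Proposition II.3, Lemmas II.4–II.5

Companion to the typer file F7a `FKTLaddersSec1.lean` (cell `gate-hubbard-kl`, statements-first wave D-0069 (2);
DAG rows `PHL.D.scalej` (Definition II.2), `PHL.P.alt` (Proposition II.3, licence F-073), `PHL.L.II` (Lemmas II.4 and
II.5, licence F-074) of HOME/DAG.tsv — the three rows F7a's module docstring lists as "NOT typed here").  F7a is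
DEFINITION-FROZEN and is imported, not edited: every object of §I used below (`SpinFourLegFn`, `ladder`, `spinLink`,
`resectFour`/`resectSpin`, `flipFn`, `bubbleScale`, `compoundLadder`, `LadderInput`, `vOf`, …) is F7a's.

Source: J. Feldman, H. Knörrer, E. Trubowitz, *Particle–Hole Ladders*, Commun. Math. Phys. **247** (2004) 179–194,
arXiv:math-ph/0209044 [FeldmanKnorrerTrubowitz2004Ladders]; locators `p.N Ln` are chunk `pNNNN.txt` line `n` of the
materialised arXiv TeX (`lit read arxiv:math-ph/0209044`; cell render HOME/dag/texts/paper-arxiv-math-ph_0209044), NOT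
printed pages.  The arXiv source numbers items by macro; as in F7a the items of §II are numbered in source order:
Convention II.1 = `\convLADresectorbullet` (p.9 L106–113), Definition II.2 = `\defLADcompoundphladderscalej` (p.9
L115–139), Proposition II.3 = `\propLADaltcmpladders` (p.9 L141 – p.10 L17), Lemma II.4 = `\lemLADaltcmpladdersII`
(p.10 L25–36, proof L37–62), Lemma II.5 = `\lemLADaltcmpladdersIII` (p.10 L63–78, proof p.10 L79 – p.11 L20); proof of
Proposition II.3 p.11 L21–38.

WHAT §II.1 DOES (p.10 L18–24, p.11 L21–38).  Definition I.20 (F7a `compoundLadder`) builds the compound particle–hole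
ladders `ℒ^{(j)}` scale by scale, resectorizing everything to `Σ_j` before joining.  Definition II.2 builds instead, for
each scale `j+1`, the sum `L^{(j+1)}` of all ladders whose rungs are `F^{(i_m)} + L^{(i_m)f}` at their OWN scales and whose
bubble propagators `𝒞^{(j_m)}` have `max j_m = j` and `i_m ≤ min(j_{m-1}, j_m)`; Proposition II.3 states that the two
book-keepings agree, `ℒ^{(j+1)} = Σ_{i ≤ j+1} L^{(i)}_{Σ_j}` (i), gives the resummed form with the range propagators
`𝒞^{[max(i_m,i_{m+1}), j]}` (ii), and the one-bubble recursion for `L^{(j+1)}` (iii).  Lemmas II.4/II.5 are (ii)/(iii) for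
the auxiliary sums `ℒ̃^{(j+1)} = Σ_{i=0}^{j+1} L^{(i)}_{Σ_j}`, from which the Proposition follows by the uniqueness of the
recursion of Definition I.20.  These identities are the input of the §II.4–§III bounds (each `L^{(j)}` is estimated once,
at its own scale).

## How the statements are typed

* STANDING ASSUMPTION OF §II (p.9 L80–87): "For the rest of the paper, we fix a sequence `F⃗` … and a sequence `p⃗` … as
  in Theorem I.21 and we set `v(k) = Σ_{i ≥ 2} p̌^{(i)}(k)`."  Exactly as for F7a's `BubbleBound` (Theorem II.18), the
  named facts below therefore repeat the outer quantifiers of Theorem I.21 (F7a `CompoundLadderBound`): admissible fixed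
  data `D`, `ε > 0`, the `ρ₀` of Theorem I.21, inputs with `LadderInput D ε ρ F p`, `ρ ≤ ρ₀`, and `v = vOf D p`.  In print
  the identities are manipulations of sums that converge by the estimates of the paper in that regime; the infinite sums
  over the ladder length `ℓ` are POINTWISE `tsum`s, as in F7a's Definition I.20 (junk `0` if not summable — F7a module
  docstring, "Encoding").
* Definition II.2 is a recursion on `j` in which `L^{(j+1)}` uses `L^{(i)}` for `i ≤ j` only ("Observe that `L^{(j)}`
  depends only on the components `F^{(2)},…,F^{(j-1)}` of `F⃗`", p.9 L137–138).  It is typed as the one-step map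
  `scaleLadderStep` (the printed right-hand side) and the predicate `IsScaleLadderFamily` ("`L` satisfies Definition
  II.2"), in the style of F7b's `IsTruncatedGamma`; the family itself is CONSTRUCTED by well-founded recursion
  (`scaleLadderFamily`) and PROVED to be the unique solution (`isScaleLadderFamily_scaleLadderFamily`,
  `IsScaleLadderFamily.unique`), so the predicate is not vacuous and the facts below speak about one definite object.
* Convention II.1 (`K + K'` := `K_{Σ_max} + K'_{Σ_max}`) is applied explicitly at each use: the rung
  `F^{(i)} + L^{(i)f}` is `F i + (L^{(i)f})_{Σ_i}` (`L^{(i)}` lives on `Σ_{i-1}`, p.9 L117), see `scaleRung`; the sums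
  `Σ F^{(i)}_{Σ_j} + ℒ^{(j)f}_{Σ_j} + ℒ^{(j)}_{Σ_j}` are written with F7a's `resectSpin` exactly as inside F7a's
  `compoundLadder` (same `j - 1` convention at `j = 0`, where every term is `0`).
* `𝒞^{[j₁,j₂]} = Σ_{j=j₁}^{j₂} 𝒞^{(j)}` is typed by its DEFINING (first) expression of (II.2), p.9 L95–97 (`bubbleSum`, a
  pointwise finite sum).  F7a's `bubbleRange` is the top/middle/bottom split of Definition II.17 of the same object; the
  two agree for admissible data and integrable propagators (closed form of (II.2), p.9 L97–100), which is not proved here.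
* Ladders with rungs at different scales are F7a's `ladder`: each joint sums the right labels of rung `m` over `Σ_{i_m}`
  and the left labels of rung `m+1` over `Σ_{i_{m+1}}` (Definition I.7 (iii)–(iv)); `[·]_{Σ_j}` is F7a's `resectFour` from
  `(Σ_{i_1}, Σ_{i_{ℓ+1}})` to `(Σ_j, Σ_j)` (Definition I.18 (ii)–(iii)).
* `ℒ̃^{(k)}` is defined in print for `k = j+1 ≥ 1` (p.10 L19–23); `tildeL D L 0 := 0` is a documented junk value never
  read by the statements (at `j = 0` all terms vanish).

No `instance`, no `notation`; nothing about the Hubbard model is asserted or denied; no sorry/axiom.  NOT typed here: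
Lemma I.15 (`PHL.L.normcmp`; needs the norms `|·˜|_{3,Σ}` and the particle–hole value/reduction of [FKTf2]/[FKTo3],
objects not in the tree).
-/

noncomputable section

open MeasureTheory Filter
open scoped Topology ENNReal

namespace Literature.MathematicalPhysics.QuantumLattice.FermiRG

namespace FKTLadders

variable (D : LadderData)

/-! ### (II.2) and Convention II.1 -/

/-- **(II.2), first expression**: `𝒞^{[j₁,j₂]} = Σ_{j=j₁}^{j₂} 𝒞^{(j)}`, the particle–hole bubble propagators of the
scales `j₁ ≤ j ≤ j₂` summed (pointwise finite sum; empty, hence `0`, if `j₂ < j₁`), with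
`𝒞^{(j)} = 𝒞(C_v^{(j)}, C_v^{(≥ j+1)})` = F7a `bubbleScale`.  Print continues
`= C_v^{(≥ j₁)} ⊗ C_v^{(≥ j₁)t} - C_v^{(≥ j₂+1)} ⊗ C_v^{(≥ j₂+1)t}` (p.9 L97–100) and Definition II.17 splits the same object
as `𝒞_tp + 𝒞_md + 𝒞_bt` (F7a `bubbleRange`); those equalities are not restated. `PHL.P.alt` · FKT-PHL (II.2) · p.9
L95–100. [cite: FeldmanKnorrerTrubowitz2004Ladders, (II.2) (p.9 L95–100)] -/
def bubbleSum (v : SpT → ℂ) (j₁ j₂ : ℕ) : BubblePropagator :=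
  ∑ j ∈ Finset.Icc j₁ j₂, bubbleScale D.S D.e v j

/-- **Convention II.1 (`\convLADresectorbullet`)**: for `K` on `(𝔜_{Σ_j})⁴` and `K'` on `(𝔜_{Σ_{j'}})⁴` (also with
spins), "`K + K'` denotes the function `K_{Σ_{max{j,j'}}} + K'_{Σ_{max{j,j'}}}` on `(𝔜_{Σ_{max{j,j'}}})⁴`" — both
summands resectorized (F7a `resectSpin`, Definition I.18) to the finer of the two scales. `PHL.D.scalej` · FKT-PHL
Convention II.1 · p.9 L106–113. [cite: FeldmanKnorrerTrubowitz2004Ladders, Convention II.1 (p.9 L106–113)] -/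
def convSum (j j' : ℕ) (K K' : SpinFourLegFn) : SpinFourLegFn :=
  resectSpin D j (max j j') K + resectSpin D j' (max j j') K'

/-! ### Definition II.2: the compound ladders `L^{(j)}` of scale exactly `j` (`PHL.D.scalej`) -/

/-- The rung `F^{(i)} + L^{(i)f}` of Definition II.2 read with Convention II.1: `F^{(i)}` lives on `Σ_i`-sectors,
`L^{(i)}` (hence its flip `L^{(i)f}`, (I.19), F7a `flipFn`) on `Σ_{i-1}`-sectors (p.9 L117), so the sum is
`F^{(i)} + (L^{(i)f})_{Σ_i}` on `(𝔜^↕_{Σ_i})⁴`. `PHL.D.scalej` · FKT-PHL Definition II.2 · p.9 L119–124.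
[cite: FeldmanKnorrerTrubowitz2004Ladders, Definition II.2 (p.9 L115–139) with Convention II.1 (p.9 L106–113)] -/
def scaleRung (F L : ℕ → SpinFourLegFn) (i : ℕ) : SpinFourLegFn :=
  F i + resectSpin D (i - 1) i (flipFn (L i))

/-- One summand of Definition II.2 before resectorization: the ladder
`(F^{(i_1)} + L^{(i_1)f}) • 𝒞^{(j_1)} • (F^{(i_2)} + L^{(i_2)f}) • ⋯ • 𝒞^{(j_ℓ)} • (F^{(i_{ℓ+1})} + L^{(i_{ℓ+1})f})` with
`ℓ = n + 1 ≥ 1` bubble propagators of scales `js : Fin (n+1) → ℕ` and `n + 2` rungs of scales `i : Fin (n+2) → ℕ`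
(F7a `ladder`; at the `m`-th joint the right labels of rung `m` are summed over `Σ_{i_m}` and the left labels of rung
`m+1` over `Σ_{i_{m+1}}`, Definition I.7 (iii)–(iv)).  A function on `𝔜⁽⁴⁾_{Σ_{i_1}, Σ_{i_{ℓ+1}}}` with spins.
`PHL.D.scalej` · FKT-PHL Definition II.2 · p.9 L119–124. [cite: FeldmanKnorrerTrubowitz2004Ladders, Definition II.2 (p.9 L115–139)] -/
def scaleLadder (v : SpT → ℂ) (F L : ℕ → SpinFourLegFn) (n : ℕ) (i : Fin (n + 2) → ℕ) (js : Fin (n + 1) → ℕ) :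
    SpinFourLegFn :=
  ladder (scaleRung D F L (i 0))
    (List.ofFn fun m : Fin (n + 1) =>
      (D.Sig (i m.castSucc), bubbleScale D.S D.e v (js m), D.Sig (i m.succ), scaleRung D F L (i m.succ)))

/-- The constraints of the primed sum `Σ'` of Definition II.2 on the scales of a summand of `L^{(j+1)}` with `n + 1`
bubbles (p.9 L120–133): rung scales `i_m ≥ 2`, bubble scales `0 ≤ j_m ≤ j` with `max{j_1,…,j_ℓ} = j`, and
`i_m ≤ min{j_{m-1}, j_m}` for every rung `m` (the bubbles adjacent to rung `m`; "when `m = 1`, `min = j_1` and when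
`m = ℓ+1`, `min = j_ℓ`", p.9 L133). `PHL.D.scalej` · FKT-PHL Definition II.2 · p.9 L125–133.
[cite: FeldmanKnorrerTrubowitz2004Ladders, Definition II.2 (p.9 L125–133)] -/
def ScaleIdxAdmissible (j n : ℕ) (i : Fin (n + 2) → ℕ) (js : Fin (n + 1) → ℕ) : Prop :=
  (∀ m, 2 ≤ i m) ∧ (∀ b, js b ≤ j) ∧ (∃ b, js b = j) ∧
    ∀ (m : Fin (n + 2)) (b : Fin (n + 1)), (b.castSucc = m ∨ b.succ = m) → i m ≤ js b

/-- The (finite) index set of `Σ'` in Definition II.2 for summands of `L^{(j+1)}` with `n + 1` bubbles: pairs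
`(i, js)` with `i_m ∈ [2, j]`, `j_m ∈ [0, j]` satisfying `ScaleIdxAdmissible` (the bound `i_m ≤ j` follows from
`i_m ≤ j_m ≤ j`). `PHL.D.scalej` · FKT-PHL Definition II.2 · p.9 L125–133.
[cite: FeldmanKnorrerTrubowitz2004Ladders, Definition II.2 (p.9 L125–133)] -/
def scaleIdxSet (j n : ℕ) : Finset ((Fin (n + 2) → ℕ) × (Fin (n + 1) → ℕ)) :=
  @Finset.filter _ (fun p => ScaleIdxAdmissible j n p.1 p.2) (Classical.decPred _)
    ((Fintype.piFinset fun _ : Fin (n + 2) => Finset.Icc 2 j) ×ˢ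
      (Fintype.piFinset fun _ : Fin (n + 1) => Finset.range (j + 1)))

/-- **The right-hand side of Definition II.2**: given the rungs `F⃗` and the previously constructed `L^{(i)}`, `i ≤ j`,
`L^{(j+1)} = Σ_{ℓ ≥ 1} Σ'_{i_1,…,i_{ℓ+1} ≥ 2; j_1,…,j_ℓ ≥ 0} [(F^{(i_1)} + L^{(i_1)f}) • 𝒞^{(j_1)} • ⋯ • 𝒞^{(j_ℓ)} •
(F^{(i_{ℓ+1})} + L^{(i_{ℓ+1})f})]_{Σ_j}` — the sum over the ladder length is a pointwise `tsum` (as in F7a's Definition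
I.20), the resectorization `[·]_{Σ_j}` is F7a's `resectFour` from `(Σ_{i_1}, Σ_{i_{ℓ+1}})` to `(Σ_j, Σ_j)`.  Only the values
`L i`, `2 ≤ i ≤ j`, are read (`scaleLadderStep_congr`). `PHL.D.scalej` · FKT-PHL Definition II.2 · p.9 L119–133.
[cite: FeldmanKnorrerTrubowitz2004Ladders, Definition II.2 (p.9 L115–139)] -/
def scaleLadderStep (v : SpT → ℂ) (F L : ℕ → SpinFourLegFn) (j : ℕ) : SpinFourLegFn :=
  fun σ c y s => ∑' n : ℕ, ∑ p ∈ scaleIdxSet j n,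
    resectFour D (p.1 0) (p.1 (Fin.last (n + 1))) j j (scaleLadder D v F L n p.1 p.2 σ) c y s

/-- **Definition II.2 (`\defLADcompoundphladderscalej`) as a predicate**: the family `(L^{(j)})_{j ≥ 0}` satisfies
`L^{(0)} = L^{(1)} = L^{(2)} = 0` and, for every `j ≥ 0`, `L^{(j+1)} =` the right-hand side `scaleLadderStep` (for
`j ≤ 1` that right-hand side is an empty sum, consistent with the printed initial values; `scaleLadderStep_of_le_one`).
In print the `L^{(j)}` are "sectorized, translation invariant, spin independent functions on `(𝔜^↕_{Σ_{j-1}})⁴`"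
(p.9 L116–117) — a description of the constructed objects, not restated.  The family exists and is unique
(`scaleLadderFamily`, `IsScaleLadderFamily.unique`). `PHL.D.scalej` · FKT-PHL Definition II.2 · p.9 L115–139.
[cite: FeldmanKnorrerTrubowitz2004Ladders, Definition II.2 (p.9 L115–139)] -/
def IsScaleLadderFamily (v : SpT → ℂ) (F L : ℕ → SpinFourLegFn) : Prop :=
  L 0 = 0 ∧ L 1 = 0 ∧ L 2 = 0 ∧ ∀ j : ℕ, L (j + 1) = scaleLadderStep D v F L j

/-- **Definition II.2, the family itself**, by well-founded recursion on the scale: `L^{(0)} = 0` and `L^{(j+1)}` is the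
printed right-hand side evaluated on `(L^{(i)})_{i ≤ j}` (values above `j` are not read; they are replaced by `0` to make
the recursion structurally evident). `PHL.D.scalej` · FKT-PHL Definition II.2 · p.9 L115–139.
[cite: FeldmanKnorrerTrubowitz2004Ladders, Definition II.2 (p.9 L115–139)] -/
def scaleLadderFamily (v : SpT → ℂ) (F : ℕ → SpinFourLegFn) : ℕ → SpinFourLegFn
  | 0 => 0
  | j + 1 => scaleLadderStep D v F (fun i => if i < j + 1 then scaleLadderFamily v F i else 0) j

/-! ### `ℒ̃` and the named facts: Proposition II.3 (F-073), Lemmas II.4–II.5 (F-074) -/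

/-- `ℒ̃^{(k)}`, `k = j + 1 ≥ 1`: "`ℒ̃^{(j+1)} = Σ_{i=0}^{j+1} L^{(i)}_{Σ_j}`" (p.10 L19–23), each `L^{(i)}` (on `Σ_{i-1}`)
resectorized to `Σ_j` (F7a `resectSpin`; the `i = 0` term is the resectorization of `L^{(0)} = 0`).  `ℒ̃^{(0)} := 0`
(print does not define it; never read). `PHL.L.II` · FKT-PHL §II.1 · p.10 L19–23.
[cite: FeldmanKnorrerTrubowitz2004Ladders, §II.1 (p.10 L19–23)] -/
def tildeL (L : ℕ → SpinFourLegFn) : ℕ → SpinFourLegFn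
  | 0 => 0
  | j + 1 => ∑ i ∈ Finset.range (j + 2), resectSpin D (i - 1) j (L i)

/-- One summand of Proposition II.3 (ii) / Lemma II.4 before resectorization: the ladder
`(F^{(i_1)} + L^{(i_1)f}) • 𝒞^{[max{i_1,i_2}, j]} • (F^{(i_2)} + L^{(i_2)f}) • ⋯ • 𝒞^{[max{i_ℓ,i_{ℓ+1}}, j]} •
(F^{(i_{ℓ+1})} + L^{(i_{ℓ+1})f})` with `ℓ = n + 1` range propagators (`bubbleSum`) and rung scales `i : Fin (n+2) → ℕ`.
`PHL.P.alt` · FKT-PHL Proposition II.3 (ii) · p.10 L1–8. [cite: FeldmanKnorrerTrubowitz2004Ladders, Proposition II.3 (ii) (p.10 L1–8)] -/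
def rangeLadder (v : SpT → ℂ) (F L : ℕ → SpinFourLegFn) (j n : ℕ) (i : Fin (n + 2) → ℕ) : SpinFourLegFn :=
  ladder (scaleRung D F L (i 0))
    (List.ofFn fun m : Fin (n + 1) =>
      (D.Sig (i m.castSucc), bubbleSum D v (max (i m.castSucc) (i m.succ)) j, D.Sig (i m.succ),
        scaleRung D F L (i m.succ)))

/-- The right-hand side of Proposition II.3 (ii) and of Lemma II.4:
`Σ_{ℓ ≥ 1} Σ_{i_1,…,i_{ℓ+1} = 2}^{j} [(F^{(i_1)} + L^{(i_1)f}) • 𝒞^{[max{i_1,i_2}, j]} • ⋯ • 𝒞^{[max{i_ℓ,i_{ℓ+1}}, j]} •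
(F^{(i_{ℓ+1})} + L^{(i_{ℓ+1})f})]_{Σ_j}` (pointwise `tsum` over the length, finite sum over the rung scales, F7a
`resectFour` to `Σ_j`). `PHL.P.alt` · FKT-PHL Proposition II.3 (ii) / Lemma II.4 · p.10 L1–8, L25–36.
[cite: FeldmanKnorrerTrubowitz2004Ladders, Proposition II.3 (ii) (p.10 L1–8) and Lemma II.4 (p.10 L25–36)] -/
def rangeLadderSum (v : SpT → ℂ) (F L : ℕ → SpinFourLegFn) (j : ℕ) : SpinFourLegFn :=
  fun σ c y s => ∑' n : ℕ, ∑ i ∈ Fintype.piFinset (fun _ : Fin (n + 2) => Finset.Icc 2 j),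
    resectFour D (i 0) (i (Fin.last (n + 1))) j j (rangeLadder D v F L j n i σ) c y s

/-- `Σ_{i=2}^{j} F^{(i)}_{Σ_j}`, the rungs up to scale `j` resectorized to `Σ_j` (the `F` of Definition I.20, p.8 L150, and of
Proposition II.3 (iii); literally F7a's `Fs` inside `compoundLadder`). [cite: FeldmanKnorrerTrubowitz2004Ladders, Definition I.20 (p.8 L150) and Proposition II.3 (iii) (p.10 L10–14)] -/
def rungSum (F : ℕ → SpinFourLegFn) (j : ℕ) : SpinFourLegFn :=
  ∑ i ∈ Finset.Icc 2 j, resectSpin D i j (F i)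

/-- **Proposition II.3 (`\propLADaltcmpladders`)**, as printed, under the standing assumption of §II (sequences `F⃗, p⃗`
fixed as in Theorem I.21, `v = Σ_{i ≥ 2} p̌^{(i)}`, p.9 L80–87 — hence the outer quantifiers of F7a's
`CompoundLadderBound`/`BubbleBound`), for the compound ladders `ℒ^{(j)} = ℒ^{(j)}_v(F⃗)` of Definition I.20 (F7a
`compoundLadder`, carried on `Σ_{j-1}`) and the family `L^{(j)}` of Definition II.2, for every `j ≥ 0`:
(i) `ℒ^{(j+1)} = Σ_{i=0}^{j+1} L^{(i)}_{Σ_j}`;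
(ii) `ℒ^{(j+1)} = Σ_{ℓ ≥ 1} Σ_{i_1,…,i_{ℓ+1}=2}^{j} [(F^{(i_1)} + L^{(i_1)f}) • 𝒞^{[max{i_1,i_2},j]} • ⋯ •
𝒞^{[max{i_ℓ,i_{ℓ+1}},j]} • (F^{(i_{ℓ+1})} + L^{(i_{ℓ+1})f})]_{Σ_j}`;
(iii) `L^{(j+1)} = (Σ_{i=2}^{j} F^{(i)}_{Σ_j} + ℒ^{(j)f}_{Σ_j} + ℒ^{(j)}_{Σ_j}) • 𝒞^{(j)} • (Σ_{i=2}^{j} F^{(i)}_{Σ_j} + ℒ^{(j)f}_{Σ_j} + ℒ^{(j+1)})`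
(one bubble `𝒞^{(j)}`, joints summed over `Σ_j`; F7a `spinLink`).  In print an identity of convergent ladder sums
(proof p.11 L21–38 from Lemmas II.4–II.5 and the uniqueness of the recursion of Definition I.20); here the sums over the
ladder length are pointwise `tsum`s as in F7a.  Wave-optional named fact (D-0014, licence F-073); nothing is instantiated
at the Hubbard model. `PHL.P.alt` · FKT-PHL Proposition II.3 · p.9 L141 – p.10 L17.
[cite: FeldmanKnorrerTrubowitz2004Ladders, Proposition II.3 (p.9 L141 – p.10 L17)] -/
def CompoundLadderResummation : Prop :=
  ∀ D : LadderData, D.Admissible → ∀ ε : ℝ, 0 < ε →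
    ∃ ρ₀ : ℝ, 0 < ρ₀ ∧
      ∀ (ρ : ℝ) (F : ℕ → SpinFourLegFn) (p : ℕ → TwoLegFn), 0 ≤ ρ → ρ ≤ ρ₀ → LadderInput D ε ρ F p →
        let v : SpT → ℂ := vOf D p
        ∀ L : ℕ → SpinFourLegFn, IsScaleLadderFamily D v F L →
          ∀ j : ℕ,
            -- (i)
            compoundLadder D F v (j + 1) = ∑ i ∈ Finset.range (j + 2), resectSpin D (i - 1) j (L i) ∧
            -- (ii)
            compoundLadder D F v (j + 1) = rangeLadderSum D v F L j ∧
            -- (iii)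
            L (j + 1) =
              spinLink (D.Sig j) (D.Sig j)
                (rungSum D F j + resectSpin D (j - 1) j (flipFn (compoundLadder D F v j)) +
                  resectSpin D (j - 1) j (compoundLadder D F v j))
                (bubbleScale D.S D.e v j)
                (rungSum D F j + resectSpin D (j - 1) j (flipFn (compoundLadder D F v j)) +
                  compoundLadder D F v (j + 1))

/-- **Lemmas II.4 (`\lemLADaltcmpladdersII`) and II.5 (`\lemLADaltcmpladdersIII`)**, as printed, under the standing
assumption of §II (as in `CompoundLadderResummation`), for the family `L^{(j)}` of Definition II.2 and
`ℒ̃^{(j+1)} = Σ_{i=0}^{j+1} L^{(i)}_{Σ_j}` (p.10 L19–23), for every `j ≥ 0`: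
(II.4) `ℒ̃^{(j+1)} = Σ_{ℓ ≥ 1} Σ_{i_1,…,i_{ℓ+1}=2}^{j} [(F^{(i_1)} + L^{(i_1)f}) • 𝒞^{[max{i_1,i_2},j]} • ⋯ •
𝒞^{[max{i_ℓ,i_{ℓ+1}},j]} • (F^{(i_{ℓ+1})} + L^{(i_{ℓ+1})f})]_{Σ_j}`;
(II.5 i) `L^{(j+1)} = (Σ_{i=2}^{j} F^{(i)}_{Σ_j} + ℒ̃^{(j)f}_{Σ_j} + ℒ̃^{(j)}_{Σ_j}) • 𝒞^{(j)} • (Σ_{i=2}^{j} F^{(i)}_{Σ_j} + ℒ̃^{(j)f}_{Σ_j} + ℒ̃^{(j+1)})`;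
(II.5 ii) `L^{(j+1)} = Σ_{ℓ ≥ 1} [(Σ_{i=2}^{j} F^{(i)}_{Σ_j} + ℒ̃^{(j)f}_{Σ_j} + ℒ̃^{(j)}_{Σ_j}) • 𝒞^{(j)}]^ℓ •
(Σ_{i=2}^{j} F^{(i)}_{Σ_j} + ℒ̃^{(j)f}_{Σ_j} + ℒ̃^{(j)}_{Σ_j})` (the ladder with `ℓ` bubbles `𝒞^{(j)}` and `ℓ+1` equal rungs,
joints over `Σ_j`).  `ℒ̃^{(j)}` lives on `Σ_{j-1}` and is resectorized to `Σ_j` where print writes the subscript.  In print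
identities of convergent sums (finite re-indexing of the scale sums, p.10 L37–62; splitting off the bubbles of scale
exactly `j`, p.10 L79 – p.11 L20); pointwise `tsum`s here.  Two lemmas, ONE wave-optional licence (F-074): typed as the
three clauses of one named fact (D-0014); nothing is instantiated at the Hubbard model. `PHL.L.II` · FKT-PHL Lemmas
II.4–II.5 · p.10 L25 – p.11 L20. [cite: FeldmanKnorrerTrubowitz2004Ladders, Lemma II.4 (p.10 L25–36) and Lemma II.5 (p.10 L63–78)] -/
def TildeLadderIdentities : Prop :=
  ∀ D : LadderData, D.Admissible → ∀ ε : ℝ, 0 < ε →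
    ∃ ρ₀ : ℝ, 0 < ρ₀ ∧
      ∀ (ρ : ℝ) (F : ℕ → SpinFourLegFn) (p : ℕ → TwoLegFn), 0 ≤ ρ → ρ ≤ ρ₀ → LadderInput D ε ρ F p →
        let v : SpT → ℂ := vOf D p
        ∀ L : ℕ → SpinFourLegFn, IsScaleLadderFamily D v F L →
          ∀ j : ℕ,
            let G : SpinFourLegFn :=
              rungSum D F j + resectSpin D (j - 1) j (flipFn (tildeL D L j)) + resectSpin D (j - 1) j (tildeL D L j)
            -- Lemma II.4
            tildeL D L (j + 1) = rangeLadderSum D v F L j ∧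
            -- Lemma II.5 (i)
            L (j + 1) =
              spinLink (D.Sig j) (D.Sig j) G (bubbleScale D.S D.e v j)
                (rungSum D F j + resectSpin D (j - 1) j (flipFn (tildeL D L j)) + tildeL D L (j + 1)) ∧
            -- Lemma II.5 (ii)
            L (j + 1) = fun σ c y s =>
              ∑' n : ℕ, ladder G (List.replicate (n + 1) (D.Sig j, bubbleScale D.S D.e v j, D.Sig j, G)) σ c y s

/-! ### Proved structural lemmas: the recursion of Definition II.2 is well posed -/

/-- Membership in the index set of `Σ'` unfolds to the printed constraints plus the ranges `2 ≤ i_m ≤ j`, `j_m ≤ j`.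
[cite: FeldmanKnorrerTrubowitz2004Ladders, Definition II.2 (p.9 L125–133)] -/
theorem mem_scaleIdxSet {j n : ℕ} {p : (Fin (n + 2) → ℕ) × (Fin (n + 1) → ℕ)} :
    p ∈ scaleIdxSet j n ↔
      (∀ m, p.1 m ∈ Finset.Icc 2 j) ∧ (∀ b, p.2 b ∈ Finset.range (j + 1)) ∧ ScaleIdxAdmissible j n p.1 p.2 := by
  unfold scaleIdxSet
  rw [@Finset.mem_filter, Finset.mem_product, Fintype.mem_piFinset, Fintype.mem_piFinset]
  tauto

/-- Every rung scale of an admissible index is at most `j` (it is bounded by an adjacent bubble scale `≤ j`).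
[cite: FeldmanKnorrerTrubowitz2004Ladders, Definition II.2 (p.9 L125–133)] -/
theorem rung_le_of_mem_scaleIdxSet {j n : ℕ} {p : (Fin (n + 2) → ℕ) × (Fin (n + 1) → ℕ)}
    (hp : p ∈ scaleIdxSet j n) (m : Fin (n + 2)) : p.1 m ≤ j :=
  (Finset.mem_Icc.mp ((mem_scaleIdxSet.mp hp).1 m)).2

/-- For `j ≤ 1` the index set of Definition II.2 is empty (`i_m ≥ 2` and `i_m ≤ j` are incompatible).
[cite: FeldmanKnorrerTrubowitz2004Ladders, Definition II.2 (p.9 L118, L125–133)] -/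
theorem scaleIdxSet_of_le_one {j : ℕ} (hj : j ≤ 1) (n : ℕ) : scaleIdxSet j n = ∅ := by
  ext p
  simp only [Finset.notMem_empty, iff_false]
  intro hp
  have h := Finset.mem_Icc.mp ((mem_scaleIdxSet.mp hp).1 0)
  omega

/-- Hence the right-hand side of Definition II.2 vanishes for `j ≤ 1`: `L^{(1)} = L^{(2)} = 0` is consistent with (indeed
forced by) the recursion. [cite: FeldmanKnorrerTrubowitz2004Ladders, Definition II.2 (p.9 L118)] -/
theorem scaleLadderStep_of_le_one (v : SpT → ℂ) (F L : ℕ → SpinFourLegFn) {j : ℕ} (hj : j ≤ 1) :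
    scaleLadderStep D v F L j = 0 := by
  funext σ c y s
  simp [scaleLadderStep, scaleIdxSet_of_le_one hj]

/-- The rung `F^{(i)} + L^{(i)f}` only reads `L` at the index `i`. [cite: FeldmanKnorrerTrubowitz2004Ladders, Definition II.2 (p.9 L119–124)] -/
theorem scaleRung_congr {F L L' : ℕ → SpinFourLegFn} {i : ℕ} (h : L i = L' i) :
    scaleRung D F L i = scaleRung D F L' i := by
  simp only [scaleRung, h]

/-- A summand of Definition II.2 only reads `L` at its rung scales. [cite: FeldmanKnorrerTrubowitz2004Ladders, Definition II.2 (p.9 L119–124)] -/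
theorem scaleLadder_congr (v : SpT → ℂ) {F L L' : ℕ → SpinFourLegFn} {n : ℕ} {i : Fin (n + 2) → ℕ}
    (js : Fin (n + 1) → ℕ) (h : ∀ m, L (i m) = L' (i m)) :
    scaleLadder D v F L n i js = scaleLadder D v F L' n i js := by
  unfold scaleLadder
  have h0 : scaleRung D F L (i 0) = scaleRung D F L' (i 0) := scaleRung_congr D (h 0)
  have hs : (fun m : Fin (n + 1) =>
      (D.Sig (i m.castSucc), bubbleScale D.S D.e v (js m), D.Sig (i m.succ), scaleRung D F L (i m.succ))) =
      fun m : Fin (n + 1) =>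
      (D.Sig (i m.castSucc), bubbleScale D.S D.e v (js m), D.Sig (i m.succ), scaleRung D F L' (i m.succ)) := by
    funext m
    rw [scaleRung_congr D (h m.succ)]
  rw [h0, hs]

/-- **"`L^{(j)}` depends only on … `F^{(2)},…,F^{(j-1)}`" (p.9 L137–138), the `L`-half**: the right-hand side of Definition
II.2 for `L^{(j+1)}` reads the family only at indices `≤ j`. [cite: FeldmanKnorrerTrubowitz2004Ladders, Definition II.2 (p.9 L137–138)] -/
theorem scaleLadderStep_congr (v : SpT → ℂ) {F L L' : ℕ → SpinFourLegFn} {j : ℕ} (h : ∀ i ≤ j, L i = L' i) :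
    scaleLadderStep D v F L j = scaleLadderStep D v F L' j := by
  funext σ c y s
  simp only [scaleLadderStep]
  refine tsum_congr fun n => Finset.sum_congr rfl fun p hp => ?_
  rw [scaleLadder_congr D v p.2 fun m => h _ (rung_le_of_mem_scaleIdxSet hp m)]

/-- The recursion equation of the constructed family: `L^{(j+1)} = scaleLadderStep … (L^{(i)})_{i} … j`.
[cite: FeldmanKnorrerTrubowitz2004Ladders, Definition II.2 (p.9 L115–139)] -/
theorem scaleLadderFamily_succ (v : SpT → ℂ) (F : ℕ → SpinFourLegFn) (j : ℕ) :
    scaleLadderFamily D v F (j + 1) = scaleLadderStep D v F (scaleLadderFamily D v F) j := by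
  rw [scaleLadderFamily]
  exact scaleLadderStep_congr D v fun i hi => by simp [Nat.lt_succ_of_le hi]

/-- **Definition II.2 is satisfied by the constructed family** (existence; in particular `IsScaleLadderFamily` is not
vacuous). [cite: FeldmanKnorrerTrubowitz2004Ladders, Definition II.2 (p.9 L115–139)] -/
theorem isScaleLadderFamily_scaleLadderFamily (v : SpT → ℂ) (F : ℕ → SpinFourLegFn) :
    IsScaleLadderFamily D v F (scaleLadderFamily D v F) := by
  refine ⟨by rw [scaleLadderFamily], ?_, ?_, fun j => scaleLadderFamily_succ D v F j⟩
  · rw [scaleLadderFamily_succ, scaleLadderStep_of_le_one D v F _ (by norm_num)]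
  · rw [scaleLadderFamily_succ, scaleLadderStep_of_le_one D v F _ (by norm_num)]

/-- **Uniqueness**: two families satisfying Definition II.2 coincide (strong induction on the scale, using
`scaleLadderStep_congr`). [cite: FeldmanKnorrerTrubowitz2004Ladders, Definition II.2 (p.9 L115–139)] -/
theorem IsScaleLadderFamily.unique {D : LadderData} {v : SpT → ℂ} {F L L' : ℕ → SpinFourLegFn}
    (hL : IsScaleLadderFamily D v F L) (hL' : IsScaleLadderFamily D v F L') : L = L' := by
  funext j
  induction j using Nat.strong_induction_on with
  | _ j ih =>
    cases j with
    | zero => rw [hL.1, hL'.1]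
    | succ j =>
      rw [hL.2.2.2 j, hL'.2.2.2 j]
      exact scaleLadderStep_congr D v fun i hi => ih i (Nat.lt_succ_of_le hi)

/-- The constructed family is THE family of Definition II.2: any solution equals it.
[cite: FeldmanKnorrerTrubowitz2004Ladders, Definition II.2 (p.9 L115–139)] -/
theorem IsScaleLadderFamily.eq_scaleLadderFamily {D : LadderData} {v : SpT → ℂ} {F L : ℕ → SpinFourLegFn}
    (hL : IsScaleLadderFamily D v F L) : L = scaleLadderFamily D v F :=
  hL.unique (isScaleLadderFamily_scaleLadderFamily D v F)

/-- `ℒ̃^{(j+1)}` unfolds to the printed sum `Σ_{i=0}^{j+1} L^{(i)}_{Σ_j}`. [cite: FeldmanKnorrerTrubowitz2004Ladders, §II.1 (p.10 L19–23)] -/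
theorem tildeL_succ (L : ℕ → SpinFourLegFn) (j : ℕ) :
    tildeL D L (j + 1) = ∑ i ∈ Finset.range (j + 2), resectSpin D (i - 1) j (L i) := by
  rw [tildeL]

/-- Proposition II.3 (i) says exactly `ℒ^{(j+1)} = ℒ̃^{(j+1)}` ("Thus `ℒ̃^{(j)}` obeys the same initial condition and
recursion relation as that defining `ℒ^{(j)}` … Therefore, they are equal", p.11 L33–36): the clause (i) of
`CompoundLadderResummation` rewritten with `tildeL`. [cite: FeldmanKnorrerTrubowitz2004Ladders, Proposition II.3 (i) (p.9 L143–145) and its proof (p.11 L33–36)] -/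
theorem compoundLadder_eq_tildeL_iff (F : ℕ → SpinFourLegFn) (v : SpT → ℂ) (L : ℕ → SpinFourLegFn) (j : ℕ) :
    compoundLadder D F v (j + 1) = tildeL D L (j + 1) ↔
      compoundLadder D F v (j + 1) = ∑ i ∈ Finset.range (j + 2), resectSpin D (i - 1) j (L i) := by
  rw [tildeL_succ]

end FKTLadders

end Literature.MathematicalPhysics.QuantumLattice.FermiRG
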